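import Mathlib

/-!
# Solo-blind: counting Bohr–Sommerfeld rungs in a window (paper §24.44–24.45, (Q)(a) bookkeeping)

For a loop action `J` that is continuous and strictly decreasing in the spectral parameter `s` on a
window `[a, b]`, the Maslov-2 Bohr–Sommerfeld rungs `J(s) = c (m + 1/2)` (`c = 2πh`, `m ∈ ℤ`) in the window
are in bijection (via `s ↦ J s`) with the admissible values `c (m + 1/2) ∈ [J b, J a]`, hence with the
integers `m` satisfying `J b ≤ c (m + 1/2) ≤ J a`.  This is the counting statement used in the end-to-end
test (24.44(2): 36 rungs at `h = 1`, 18 at `h = 2` in the clean window) and, with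
`SoloBlindSimultaneousMidgap`, in the mid-gap selection of 24.45.

* `bs_rungs_bijOn`     — `BijOn J {rungs in [a,b]} {admissible values in [J b, J a]}`.
* `bs_rungs_ncard_eq`  — the two sets have the same `ncard`, and the value set is the injective image of
                          the integer set `{m | J b ≤ c (m + 1/2) ≤ J a}`, so all three counts agree.
* `bs_rungs_ncard`     — closed form `(⌊J a/c - 1/2⌋ + 1 - ⌈J b/c - 1/2⌉).toNat` for `c > 0`.
-/

namespace Summit.AnomalousDissipation.AnomalousDissipation.Theorems

open Set

/-- The rung set of a window. -/
def bsRungs (J : ℝ → ℝ) (a b c : ℝ) : Set ℝ :=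
  {s | s ∈ Icc a b ∧ ∃ m : ℤ, J s = c * ((m : ℝ) + 1 / 2)}

/-- The admissible quantised values in `[J b, J a]`. -/
def bsValues (J : ℝ → ℝ) (a b c : ℝ) : Set ℝ :=
  {v | v ∈ Icc (J b) (J a) ∧ ∃ m : ℤ, v = c * ((m : ℝ) + 1 / 2)}

/-- The admissible integers. -/
def bsInts (J : ℝ → ℝ) (a b c : ℝ) : Set ℤ :=
  {m | J b ≤ c * ((m : ℝ) + 1 / 2) ∧ c * ((m : ℝ) + 1 / 2) ≤ J a}

/-- Rungs ↔ admissible values, via `s ↦ J s` (strictly decreasing continuous action). -/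
theorem bs_rungs_bijOn (J : ℝ → ℝ) (a b c : ℝ) (hab : a ≤ b)
    (hJ : StrictAntiOn J (Icc a b)) (hcont : ContinuousOn J (Icc a b)) :
    BijOn J (bsRungs J a b c) (bsValues J a b c) := by
  refine ⟨?_, ?_, ?_⟩
  · -- maps to
    intro s hs
    obtain ⟨hsI, m, hm⟩ := hs
    refine ⟨⟨?_, ?_⟩, m, hm⟩
    · exact hJ.antitoneOn hsI (right_mem_Icc.mpr hab) hsI.2
    · exact hJ.antitoneOn (left_mem_Icc.mpr hab) hsI hsI.1
  · -- injective
    intro s hs t ht hst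
    exact hJ.injOn hs.1 ht.1 hst
  · -- surjective
    intro v hv
    obtain ⟨hvI, m, hm⟩ := hv
    obtain ⟨s, hsI, hs⟩ := intermediate_value_Icc' hab hcont hvI
    exact ⟨s, ⟨hsI, m, by rw [hs, hm]⟩, hs⟩

/-- Admissible values are the injective image of the admissible integers. -/
theorem bs_values_eq_image (J : ℝ → ℝ) (a b c : ℝ) :
    bsValues J a b c = (fun m : ℤ => c * ((m : ℝ) + 1 / 2)) '' bsInts J a b c := by
  ext v
  constructor
  · rintro ⟨hvI, m, hm⟩
    refine ⟨m, ?_, hm.symm⟩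
    exact ⟨hm ▸ hvI.1, hm ▸ hvI.2⟩
  · rintro ⟨m, hm, rfl⟩
    exact ⟨⟨hm.1, hm.2⟩, m, rfl⟩

/-- `m ↦ c (m + 1/2)` is injective on `ℤ` for `c ≠ 0`. -/
theorem bs_intMap_injective (c : ℝ) (hc : c ≠ 0) :
    Function.Injective (fun m : ℤ => c * ((m : ℝ) + 1 / 2)) := by
  intro m n h
  have h1 : ((m : ℝ) + 1 / 2) = ((n : ℝ) + 1 / 2) := mul_left_cancel₀ hc h
  have h2 : (m : ℝ) = (n : ℝ) := by linarith
  exact_mod_cast h2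

/-- **Rung count.** Number of rungs in the window = number of admissible values = number of admissible
integers (all as `Set.ncard`; the sets are finite whenever `c ≠ 0`, and `ncard` agrees regardless). -/
theorem bs_rungs_ncard_eq (J : ℝ → ℝ) (a b c : ℝ) (hab : a ≤ b) (hc : c ≠ 0)
    (hJ : StrictAntiOn J (Icc a b)) (hcont : ContinuousOn J (Icc a b)) :
    (bsRungs J a b c).ncard = (bsValues J a b c).ncard ∧
      (bsValues J a b c).ncard = (bsInts J a b c).ncard := by
  have hbij := bs_rungs_bijOn J a b c hab hJ hcont
  constructor
  · rw [← hbij.image_eq]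
    exact (hbij.injOn.ncard_image).symm
  · rw [bs_values_eq_image]
    exact ncard_image_of_injective _ (bs_intMap_injective c hc)

/-- Closed form of the admissible integers for `c > 0`. -/
theorem bsInts_eq_Icc (J : ℝ → ℝ) (a b c : ℝ) (hc : 0 < c) :
    bsInts J a b c = Set.Icc ⌈J b / c - 1 / 2⌉ ⌊J a / c - 1 / 2⌋ := by
  ext m
  simp only [bsInts, Set.mem_setOf_eq, Set.mem_Icc, Int.ceil_le, Int.le_floor]
  constructor
  · rintro ⟨h1, h2⟩
    constructor
    · rw [sub_le_iff_le_add, div_le_iff₀ hc]; linarith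
    · rw [le_sub_iff_add_le, le_div_iff₀ hc]; linarith
  · rintro ⟨h1, h2⟩
    rw [sub_le_iff_le_add, div_le_iff₀ hc] at h1
    rw [le_sub_iff_add_le, le_div_iff₀ hc] at h2
    constructor <;> linarith

/-- **Rung count, closed form** (`c = 2πh > 0`): the number of Maslov-2 rungs of a continuous strictly
decreasing action in the window `[a, b]` is `(⌊J a / c - 1/2⌋ + 1 - ⌈J b / c - 1/2⌉).toNat`. -/
theorem bs_rungs_ncard (J : ℝ → ℝ) (a b c : ℝ) (hab : a ≤ b) (hc : 0 < c)
    (hJ : StrictAntiOn J (Icc a b)) (hcont : ContinuousOn J (Icc a b)) :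
    (bsRungs J a b c).ncard = (⌊J a / c - 1 / 2⌋ + 1 - ⌈J b / c - 1 / 2⌉).toNat := by
  obtain ⟨h1, h2⟩ := bs_rungs_ncard_eq J a b c hab hc.ne' hJ hcont
  rw [h1, h2, bsInts_eq_Icc J a b c hc, ← Finset.coe_Icc, Set.ncard_coe_finset, Int.card_Icc]

end Summit.AnomalousDissipation.AnomalousDissipation.Theorems
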